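import Literature.NumberTheory.LFunctions.LiouvilleHarmonicSum
import Literature.NumberTheory.LFunctions.MoebiusLogHarmonicSum
import Mathlib.NumberTheory.ZetaValues
import HarnessLib

/-!
# `∑_{n ≤ x} λ(n) log n / n = −ζ(2) + O(exp(−c √log x))` for the Liouville function

Topic `Literature/NumberTheory/LFunctions`. Everything in this file is PROVED. With
`m(y) = ∑_{k ≤ y} μ(k)/k ≪ e^{−c√log y}` (`abs_sum_moebius_div_le_exp_neg_sqrt_log`),
`g(y) = ∑_{k ≤ y} μ(k) log k/k = −1 + O(e^{−c√log y})` (`abs_sum_moebius_mul_log_div_add_one_le`,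
`MoebiusLogHarmonicSum.lean`) and `λ = 𝟙_□ ⋆ μ`:

* `LiouvilleSum.sum_liouville_mul_log_div_eq` —
  `∑_{n ≤ N} λ(n) log n/n = ∑_{a ≤ N} 𝟙_□(a) a⁻¹ (log a · m(N/a) + g(N/a))`;
* `LiouvilleSum.abs_sum_indicator_isSquare_div_sub_le` — `|∑_{a ≤ N} 𝟙_□(a)/a − π²/6| ≤ 1/⌊√N⌋`
  (`∑_{r ≤ R} r⁻² = ζ(2) + O(1/R)`, Mathlib's `hasSum_zeta_two`);
* `abs_sum_liouville_mul_log_div_add_le` — there are `c > 0`, `C` with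
  `|∑_{n ≤ x} λ(n) log n / n + π²/6| ≤ C exp(−c√log x)` for all `x ≥ 2`;
* `tendsto_sum_liouville_mul_log_div` — `∑_{n ≤ N} λ(n) log n/n → −π²/6 = −ζ(2)`.

Since `∑ λ(n) n^{−s} = ζ(2s)/ζ(s) =: F(s)`, this is `−F'(1) = −ζ(2) = −∏_p (1 − p^{−2})^{−1}`, the
value behind the main term of Matomäki–Merikoski, arXiv:2112.11412, §6 (proof of Lemma 2.4: "From the
residue at `s = 0` we get a main term `∑_d λ_d λ_L(d) d^{−1} F'(1)`"), here in real-variable form.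

## References

* H. L. Montgomery, R. C. Vaughan, *Multiplicative Number Theory I*, CUP 2007, §6.2.1 Exercise 11 and
  §8.1. [cite: MontgomeryVaughan2007, §6.2.1 Exercise 11]
* K. Matomäki, J. Merikoski, IMRN 2023 (arXiv:2112.11412), §6. [cite: MatomakiMerikoski2023, §6]
-/

noncomputable section

open Finset Real Filter ArithmeticFunction
open scoped ArithmeticFunction.Moebius

namespace Literature.NumberTheory.LFunctions

namespace LiouvilleSum

open SiegelWalfiszLiouville

/-! ### Dirichlet's rearrangement for `∑ λ(n) log n/n` -/

/-- **`∑_{n ≤ N} λ(n) log n/n = ∑_{a ≤ N} 𝟙_□(a) a⁻¹ (log a · ∑_{k ≤ N/a} μ(k)/k + ∑_{k ≤ N/a} μ(k) log k/k)`**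
(`λ = 𝟙_□ ⋆ μ`, `log(ak) = log a + log k`). [folklore] -/
theorem sum_liouville_mul_log_div_eq (N : ℕ) :
    ∑ n ∈ Icc 1 N, (liouville n : ℝ) * Real.log n / n =
      ∑ a ∈ Ioc 0 N, (if IsSquare a then (1 : ℝ) else 0) *
        ((a : ℝ)⁻¹ * (Real.log a * ∑ k ∈ Icc 1 (N / a), (μ k : ℝ) / k +
          ∑ k ∈ Icc 1 (N / a), (μ k : ℝ) * Real.log k / k)) := by
  have hIcc : ∀ M : ℕ, Icc 1 M = Ioc 0 M := fun M => rfl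
  rw [hIcc]
  have h1 : ∀ n ∈ Ioc 0 N, (liouville n : ℝ) * Real.log n / n =
      ∑ x ∈ n.divisorsAntidiagonal, (if IsSquare x.1 then (1 : ℝ) else 0) *
        ((x.1 : ℝ)⁻¹ * (Real.log x.1 * ((μ x.2 : ℝ) / x.2) + (μ x.2 : ℝ) * Real.log x.2 / x.2)) := by
    intro n _
    rw [liouville_eq_sum_antidiagonal n, sum_mul, sum_div]
    refine sum_congr rfl fun x hx => ?_
    rw [Nat.mem_divisorsAntidiagonal] at hx
    have h1' : x.1 ≠ 0 := left_ne_zero_of_mul (hx.1.symm ▸ hx.2)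
    have h2' : x.2 ≠ 0 := right_ne_zero_of_mul (hx.1.symm ▸ hx.2)
    have h1 : (0 : ℝ) < x.1 := by exact_mod_cast Nat.pos_of_ne_zero h1'
    have h2 : (0 : ℝ) < x.2 := by exact_mod_cast Nat.pos_of_ne_zero h2'
    rw [← hx.1, Nat.cast_mul, Real.log_mul h1.ne' h2.ne']
    field_simp
  rw [sum_congr rfl h1, sum_Ioc_sum_divisorsAntidiagonal_eq
    (fun a k => (if IsSquare a then (1 : ℝ) else 0) *
      ((a : ℝ)⁻¹ * (Real.log a * ((μ k : ℝ) / k) + (μ k : ℝ) * Real.log k / k))) N]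
  refine sum_congr rfl fun a _ => ?_
  rw [hIcc, mul_sum, ← sum_add_distrib, mul_sum, mul_sum]

/-! ### `∑_{a ≤ N} 𝟙_□(a)/a = ζ(2) + O(N^{-1/2})` -/

/-- `∑_{A < a ≤ B} 𝟙_□(a) f(a) = ∑_{√A < r ≤ √B} f(r²)` for `A = 0`:
`∑_{a ≤ B} 𝟙_□(a) f(a) = ∑_{r ≤ √B} f(r²)`. [folklore] -/
theorem sum_Ioc_indicator_isSquare_mul_eq (f : ℕ → ℝ) (B : ℕ) :
    ∑ a ∈ Ioc 0 B, (if IsSquare a then (1 : ℝ) else 0) * f a =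
      ∑ r ∈ Ioc 0 (Nat.sqrt B), f (r * r) := by
  have h1 : ∑ a ∈ Ioc 0 B, (if IsSquare a then (1 : ℝ) else 0) * f a =
      ∑ a ∈ (Ioc 0 B).filter IsSquare, f a := by
    rw [sum_filter]
    refine sum_congr rfl fun a _ => ?_
    split_ifs <;> simp
  have hinj : Set.InjOn (fun r : ℕ => r * r) ↑(Ioc 0 (Nat.sqrt B)) :=
    fun r _ s _ h => Nat.mul_self_inj.mp h
  rw [h1, filter_isSquare_Ioc_eq_image, sum_image hinj]

/-- **`∑_{r ≤ R} 1/r² = π²/6 − θ/R`, `0 ≤ θ ≤ 1`** (`R ≥ 1`): `|∑_{r ≤ R} r⁻² − π²/6| ≤ 1/R`,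
from Mathlib's `hasSum_zeta_two` and `∑_{R < r ≤ S} r⁻² ≤ 1/R`. [folklore] -/
theorem abs_sum_Ioc_inv_sq_sub_le {R : ℕ} (hR : 1 ≤ R) :
    |∑ r ∈ Ioc 0 R, (1 : ℝ) / (r : ℝ) ^ 2 - π ^ 2 / 6| ≤ 1 / (R : ℝ) := by
  -- partial sums over `Ioc 0 S` tend to `π²/6`
  have hlim : Tendsto (fun S : ℕ => ∑ r ∈ Ioc 0 S, (1 : ℝ) / (r : ℝ) ^ 2) atTop (nhds (π ^ 2 / 6)) := by
    have h := hasSum_zeta_two.tendsto_sum_nat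
    have h' : Tendsto (fun S : ℕ => ∑ r ∈ Finset.range (S + 1), (1 : ℝ) / (r : ℝ) ^ 2) atTop
        (nhds (π ^ 2 / 6)) := h.comp (tendsto_add_atTop_nat 1)
    refine h'.congr fun S => ?_
    rw [Finset.range_eq_Ico, show Finset.Ico 0 (S + 1) = insert 0 (Ioc 0 S) by
      ext r; simp only [Finset.mem_Ico, Finset.mem_insert, Finset.mem_Ioc]; omega]
    rw [sum_insert (by simp)]
    simp
  -- `∑_{Ioc 0 S} − ∑_{Ioc 0 R} = ∑_{Ioc R S} ∈ [0, 1/R]` for `S ≥ R`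
  have hdiff : ∀ S : ℕ, R ≤ S → ∑ r ∈ Ioc 0 S, (1 : ℝ) / (r : ℝ) ^ 2 - ∑ r ∈ Ioc 0 R, (1 : ℝ) / (r : ℝ) ^ 2 =
      ∑ r ∈ Ioc R S, (1 : ℝ) / (r : ℝ) ^ 2 := by
    intro S hS
    rw [← sum_Ioc_consecutive _ (Nat.zero_le R) hS]
    ring
  have hlim' : Tendsto (fun S : ℕ => ∑ r ∈ Ioc 0 S, (1 : ℝ) / (r : ℝ) ^ 2 -
      ∑ r ∈ Ioc 0 R, (1 : ℝ) / (r : ℝ) ^ 2) atTop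
      (nhds (π ^ 2 / 6 - ∑ r ∈ Ioc 0 R, (1 : ℝ) / (r : ℝ) ^ 2)) := hlim.sub_const _
  have hup : π ^ 2 / 6 - ∑ r ∈ Ioc 0 R, (1 : ℝ) / (r : ℝ) ^ 2 ≤ 1 / R := by
    refine le_of_tendsto hlim' ?_
    filter_upwards [eventually_ge_atTop R] with S hS
    rw [hdiff S hS]
    exact sum_Ioc_inv_sq_le hR S
  have hlow : 0 ≤ π ^ 2 / 6 - ∑ r ∈ Ioc 0 R, (1 : ℝ) / (r : ℝ) ^ 2 := by
    refine ge_of_tendsto hlim' ?_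
    filter_upwards [eventually_ge_atTop R] with S hS
    rw [hdiff S hS]
    exact sum_nonneg fun r _ => by positivity
  rw [abs_sub_comm, abs_of_nonneg hlow]
  exact hup

/-- **`|∑_{a ≤ N} 𝟙_□(a)/a − π²/6| ≤ 1/⌊√N⌋`** for `N ≥ 1`. [folklore] -/
theorem abs_sum_indicator_isSquare_div_sub_le {N : ℕ} (hN : 1 ≤ N) :
    |∑ a ∈ Ioc 0 N, (if IsSquare a then (1 : ℝ) else 0) * (a : ℝ)⁻¹ - π ^ 2 / 6| ≤
      1 / (Nat.sqrt N : ℝ) := by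
  rw [sum_Ioc_indicator_isSquare_mul_eq]
  have hR : 1 ≤ Nat.sqrt N := Nat.le_sqrt.mpr (by simpa using hN)
  have heq : ∑ r ∈ Ioc 0 (Nat.sqrt N), ((r * r : ℕ) : ℝ)⁻¹ = ∑ r ∈ Ioc 0 (Nat.sqrt N), (1 : ℝ) / (r : ℝ) ^ 2 :=
    sum_congr rfl fun r _ => by rw [Nat.cast_mul, one_div, sq]
  rw [heq]
  exact abs_sum_Ioc_inv_sq_sub_le hR

/-! ### Elementary bounds -/

/-- `|∑_{k ≤ M} μ(k) log k/k| ≤ log M (1 + log M)`. [folklore] -/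
theorem abs_sum_moebius_mul_log_div_le (M : ℕ) :
    |∑ k ∈ Icc 1 M, (μ k : ℝ) * Real.log k / k| ≤ Real.log M * (1 + Real.log M) := by
  rcases Nat.eq_zero_or_pos M with rfl | hM
  · simp
  have hM0 : (0 : ℝ) < M := by exact_mod_cast hM
  have hlogM : 0 ≤ Real.log M := Real.log_nonneg (by exact_mod_cast hM)
  calc |∑ k ∈ Icc 1 M, (μ k : ℝ) * Real.log k / k| ≤ ∑ k ∈ Icc 1 M, |(μ k : ℝ) * Real.log k / k| :=
        abs_sum_le_sum_abs _ _
    _ ≤ ∑ k ∈ Icc 1 M, Real.log M * (k : ℝ)⁻¹ := sum_le_sum fun k hk => by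
        obtain ⟨hk1, hkM⟩ := mem_Icc.mp hk
        have hk0 : (0 : ℝ) < k := by exact_mod_cast hk1
        have hlogk : 0 ≤ Real.log k := Real.log_nonneg (by exact_mod_cast hk1)
        have hlogkM : Real.log k ≤ Real.log M := Real.log_le_log hk0 (by exact_mod_cast hkM)
        rw [abs_div, abs_of_pos hk0, abs_mul, abs_of_nonneg hlogk, div_eq_mul_inv]
        refine mul_le_mul_of_nonneg_right ?_ (inv_pos.mpr hk0).le
        calc |(μ k : ℝ)| * Real.log k ≤ 1 * Real.log k :=
              mul_le_mul_of_nonneg_right (by exact_mod_cast ArithmeticFunction.abs_moebius_le_one) hlogk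
          _ ≤ Real.log M := by rw [one_mul]; exact hlogkM
    _ = Real.log M * ∑ k ∈ Ioc 0 M, (k : ℝ)⁻¹ := by rw [← mul_sum]; rfl
    _ ≤ Real.log M * (1 + Real.log M) :=
        mul_le_mul_of_nonneg_left (LiouvilleSum.sum_Ioc_inv_le_one_add_log M) hlogM

/-- Patching an eventual bound `|g(x)| ≤ C e^{−c√log x}` (`x ≥ X₀`) with the trivial bound
`|g(x)| ≤ x²` on `[2, X₀]`. [folklore] -/
theorem forall_two_le_of_forall_ge_exp_sq {g : ℝ → ℝ} (hg : ∀ x, 2 ≤ x → |g x| ≤ x ^ 2)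
    {c C X₀ : ℝ} (h : ∀ x, X₀ ≤ x → |g x| ≤ C * Real.exp (-c * Real.sqrt (Real.log x))) :
    ∃ C' : ℝ, ∀ x, 2 ≤ x → |g x| ≤ C' * Real.exp (-c * Real.sqrt (Real.log x)) := by
  set X₁ : ℝ := max X₀ 2 with hX₁
  set m : ℝ := Real.exp (-|c| * Real.sqrt (Real.log X₁)) with hm
  have hm0 : 0 < m := Real.exp_pos _
  have hX₁0 : 0 ≤ X₁ := le_trans zero_le_two (le_max_right _ _)
  refine ⟨max C 0 + X₁ ^ 2 * m⁻¹, fun x hx => ?_⟩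
  have hE0 : 0 < Real.exp (-c * Real.sqrt (Real.log x)) := Real.exp_pos _
  rcases le_or_gt X₀ x with hxX | hxX
  · calc |g x| ≤ C * Real.exp (-c * Real.sqrt (Real.log x)) := h x hxX
      _ ≤ (max C 0 + X₁ ^ 2 * m⁻¹) * Real.exp (-c * Real.sqrt (Real.log x)) := by
          gcongr
          linarith [le_max_left C 0, mul_nonneg (sq_nonneg X₁) (inv_pos.mpr hm0).le]
  · have hxX₁ : x ≤ X₁ := hxX.le.trans (le_max_left _ _)
    have hmx : m ≤ Real.exp (-c * Real.sqrt (Real.log x)) := by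
      refine Real.exp_le_exp.mpr ?_
      have h1 : Real.sqrt (Real.log x) ≤ Real.sqrt (Real.log X₁) :=
        Real.sqrt_le_sqrt (Real.log_le_log (by linarith) hxX₁)
      have h2 : 0 ≤ Real.sqrt (Real.log x) := Real.sqrt_nonneg _
      have h3 : -|c| * Real.sqrt (Real.log x) ≤ -c * Real.sqrt (Real.log x) :=
        mul_le_mul_of_nonneg_right (neg_le_neg (le_abs_self c)) h2
      have h4 : -|c| * Real.sqrt (Real.log X₁) ≤ -|c| * Real.sqrt (Real.log x) :=
        mul_le_mul_of_nonpos_left h1 (by simp [abs_nonneg])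
      linarith
    have hx0 : 0 ≤ x := by linarith
    calc |g x| ≤ x ^ 2 := hg x hx
      _ ≤ X₁ ^ 2 := pow_le_pow_left₀ hx0 hxX₁ 2
      _ = X₁ ^ 2 * m⁻¹ * m := by field_simp
      _ ≤ X₁ ^ 2 * m⁻¹ * Real.exp (-c * Real.sqrt (Real.log x)) := by gcongr
      _ ≤ (max C 0 + X₁ ^ 2 * m⁻¹) * Real.exp (-c * Real.sqrt (Real.log x)) := by
          gcongr
          linarith [le_max_right C 0]

/-- The trivial bound `|∑_{n ≤ x} λ(n) log n/n + π²/6| ≤ x²` for `x ≥ 2`. [folklore] -/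
theorem abs_sum_liouville_mul_log_div_add_le_sq {x : ℝ} (hx : 2 ≤ x) :
    |∑ n ∈ Icc 1 ⌊x⌋₊, (liouville n : ℝ) * Real.log n / n + π ^ 2 / 6| ≤ x ^ 2 := by
  have hx0 : 0 < x := by linarith
  have hN1 : 1 ≤ ⌊x⌋₊ := Nat.le_floor (by norm_num; linarith)
  have hN0 : (0 : ℝ) < ⌊x⌋₊ := by exact_mod_cast hN1
  have hL : Real.log ⌊x⌋₊ ≤ Real.log x := Real.log_le_log hN0 (Nat.floor_le hx0.le)
  have hL0 : 0 ≤ Real.log ⌊x⌋₊ := Real.log_nonneg (by exact_mod_cast hN1)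
  have hLx : Real.log x ≤ x - 1 := by
    have := Real.add_one_le_exp (Real.log x)
    rw [Real.exp_log hx0] at this
    linarith
  have hpi : π ^ 2 / 6 ≤ 2 := by
    have := Real.pi_lt_d2
    nlinarith [Real.pi_pos]
  have hsum : |∑ n ∈ Icc 1 ⌊x⌋₊, (liouville n : ℝ) * Real.log n / n| ≤ Real.log x * (1 + Real.log x) := by
    calc |∑ n ∈ Icc 1 ⌊x⌋₊, (liouville n : ℝ) * Real.log n / n|
        ≤ ∑ n ∈ Icc 1 ⌊x⌋₊, |(liouville n : ℝ) * Real.log n / n| := abs_sum_le_sum_abs _ _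
      _ ≤ ∑ n ∈ Icc 1 ⌊x⌋₊, Real.log ⌊x⌋₊ * (n : ℝ)⁻¹ := sum_le_sum fun n hn => by
          obtain ⟨hn1, hnN⟩ := mem_Icc.mp hn
          have hn0 : (0 : ℝ) < n := by exact_mod_cast hn1
          have hlogn : 0 ≤ Real.log n := Real.log_nonneg (by exact_mod_cast hn1)
          have hlognN : Real.log n ≤ Real.log ⌊x⌋₊ := Real.log_le_log hn0 (by exact_mod_cast hnN)
          rw [abs_div, abs_of_pos hn0, abs_mul, abs_of_nonneg hlogn, div_eq_mul_inv]
          refine mul_le_mul_of_nonneg_right ?_ (inv_pos.mpr hn0).le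
          calc |(liouville n : ℝ)| * Real.log n ≤ 1 * Real.log n :=
                mul_le_mul_of_nonneg_right (LiouvilleSum.abs_liouville_le_one n) hlogn
            _ ≤ Real.log ⌊x⌋₊ := by rw [one_mul]; exact hlognN
      _ = Real.log ⌊x⌋₊ * ∑ n ∈ Ioc 0 ⌊x⌋₊, (n : ℝ)⁻¹ := by rw [← mul_sum]; rfl
      _ ≤ Real.log ⌊x⌋₊ * (1 + Real.log ⌊x⌋₊) :=
          mul_le_mul_of_nonneg_left (LiouvilleSum.sum_Ioc_inv_le_one_add_log _) hL0
      _ ≤ Real.log x * (1 + Real.log x) :=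
          mul_le_mul hL (by linarith) (by linarith) (by linarith)
  calc |∑ n ∈ Icc 1 ⌊x⌋₊, (liouville n : ℝ) * Real.log n / n + π ^ 2 / 6|
      ≤ |∑ n ∈ Icc 1 ⌊x⌋₊, (liouville n : ℝ) * Real.log n / n| + |π ^ 2 / 6| := abs_add_le _ _
    _ ≤ Real.log x * (1 + Real.log x) + 2 := by
        rw [abs_of_nonneg (by positivity : (0 : ℝ) ≤ π ^ 2 / 6)]; exact add_le_add hsum hpi
    _ ≤ x ^ 2 := by nlinarith

/-! ### The estimate -/

set_option maxHeartbeats 1600000 in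
/-- The core estimate for large `x`: with `c₀ ≤ 1/4`, `C₁, C₂ ≥ 0` such that
`|m(y)| ≤ C₁ e^{−c₀√log y}` and `|g(y) + 1| ≤ C₂ e^{−c₀√log y}` for `y ≥ 2`
(`m(y) = ∑_{k ≤ y} μ(k)/k`, `g(y) = ∑_{k ≤ y} μ(k) log k/k`), one has for `x ≥ 16`
`|∑_{n ≤ x} λ(n) log n/n + π²/6| ≤ (2C₁(6144/c₀⁴ + 1) + 2C₂ + 1282) e^{−(c₀/4)√log x}`. [folklore] -/
theorem abs_sum_liouville_mul_log_div_add_le_of_bound {c₀ C₁ C₂ : ℝ} (hc₀ : 0 < c₀)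
    (hc₀' : c₀ ≤ 1 / 4) (hC₁ : 0 ≤ C₁) (hC₂ : 0 ≤ C₂)
    (hm : ∀ y : ℝ, 2 ≤ y → |∑ k ∈ Icc 1 ⌊y⌋₊, (μ k : ℝ) / k| ≤
      C₁ * Real.exp (-c₀ * Real.sqrt (Real.log y)))
    (hg : ∀ y : ℝ, 2 ≤ y → |∑ k ∈ Icc 1 ⌊y⌋₊, (μ k : ℝ) * Real.log k / k + 1| ≤
      C₂ * Real.exp (-c₀ * Real.sqrt (Real.log y))) {x : ℝ} (hx : 16 ≤ x) :
    |∑ n ∈ Icc 1 ⌊x⌋₊, (liouville n : ℝ) * Real.log n / n + π ^ 2 / 6| ≤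
      (2 * C₁ * (24 / (c₀ / 4) ^ 4 + 1) + 2 * C₂ + 1282) *
        Real.exp (-(c₀ / 4) * Real.sqrt (Real.log x)) := by
  have hx0 : 0 < x := by linarith
  have hx1 : 1 ≤ x := by linarith
  set L : ℝ := Real.log x with hLdef
  have hL1 : 1 ≤ L := by
    rw [hLdef, ← Real.log_exp 1]
    exact Real.log_le_log (Real.exp_pos 1) (by have := Real.exp_one_lt_d9; linarith)
  have hL0 : 0 < L := by linarith
  set u : ℝ := Real.sqrt L with hudef
  have hu1 : 1 ≤ u := by rw [hudef, ← Real.sqrt_one]; exact Real.sqrt_le_sqrt hL1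
  have hu0 : 0 ≤ u := by linarith
  have huL : u ^ 2 = L := Real.sq_sqrt hL0.le
  have huL' : u ≤ L := by nlinarith
  -- `√x ≥ 4`
  have hsx : 4 ≤ Real.sqrt x := by
    rw [show (4 : ℝ) = Real.sqrt 16 by rw [show (16 : ℝ) = 4 ^ 2 by norm_num,
      Real.sqrt_sq (by norm_num)]]
    exact Real.sqrt_le_sqrt hx
  have hsx0 : 0 < Real.sqrt x := by linarith
  have hsxx : Real.sqrt x ≤ x := by
    rw [Real.sqrt_le_left hx0.le]
    nlinarith
  have hxsx : x / Real.sqrt x = Real.sqrt x := by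
    rw [div_eq_iff hsx0.ne', Real.mul_self_sqrt hx0.le]
  set N : ℕ := ⌊x⌋₊ with hN
  set A₀ : ℕ := ⌊Real.sqrt x⌋₊ with hA₀
  have hA₀le : (A₀ : ℝ) ≤ Real.sqrt x := Nat.floor_le hsx0.le
  have hA₀N : A₀ ≤ N := Nat.floor_le_floor hsxx
  have hA₀1 : 1 ≤ A₀ := Nat.le_floor (by norm_num; linarith)
  have hN1 : 1 ≤ N := le_trans hA₀1 hA₀N
  have hNx : (N : ℝ) ≤ x := Nat.floor_le hx0.le
  -- the target rate and the two elementary decay facts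
  set E : ℝ := Real.exp (-(c₀ / 4) * u) with hEdef
  have hE0 : 0 < E := Real.exp_pos _
  have hE8 : Real.exp (-(L / 8)) ≤ E := by
    rw [hEdef]
    refine Real.exp_le_exp.mpr ?_
    have : c₀ / 4 * u ≤ L / 8 := by nlinarith
    linarith
  have hE2 : Real.exp (-(c₀ / 2) * u) ≤ E := by
    rw [hEdef]; exact Real.exp_le_exp.mpr (by nlinarith)
  -- `1/Nat.sqrt A₀ ≤ 2 e^{-L/4}`
  have hsqrtA : 1 / (Nat.sqrt A₀ : ℝ) ≤ 2 * Real.exp (-(L / 4)) := by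
    set R : ℕ := Nat.sqrt A₀ with hR
    have hR1 : 1 ≤ R := Nat.le_sqrt.mpr (by simpa using hA₀1)
    have hR0 : (0 : ℝ) < R := by exact_mod_cast hR1
    have h1 : A₀ + 1 ≤ (R + 1) ^ 2 := by
      have := Nat.lt_succ_sqrt A₀
      rw [hR]
      nlinarith
    have h2 : Real.sqrt x < (R : ℝ) + 1 + ((R : ℝ) + 1) * R := by
      have h3 : Real.sqrt x < (A₀ : ℝ) + 1 := Nat.lt_floor_add_one _
      have h4 : ((A₀ + 1 : ℕ) : ℝ) ≤ (((R + 1) ^ 2 : ℕ) : ℝ) := by exact_mod_cast h1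
      push_cast at h4
      nlinarith
    have hexpL2 : Real.exp (L / 2) = Real.sqrt x := by
      rw [hLdef, Real.sqrt_eq_rpow, Real.rpow_def_of_pos hx0]
      ring_nf
    have h5 : Real.sqrt x ≤ 4 * (R : ℝ) ^ 2 := by
      have hR1' : (1 : ℝ) ≤ R := by exact_mod_cast hR1
      nlinarith
    have h6 : Real.exp (L / 4) ≤ 2 * R := by
      have h7 : Real.exp (L / 4) ^ 2 ≤ (2 * (R : ℝ)) ^ 2 := by
        rw [← Real.exp_nat_mul]
        push_cast
        rw [show (2 : ℝ) * (L / 4) = L / 2 by ring, hexpL2]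
        nlinarith
      exact (pow_le_pow_iff_left₀ (Real.exp_pos _).le (by positivity) two_ne_zero).mp h7
    have h7 : 1 / (R : ℝ) ≤ 2 / Real.exp (L / 4) := by
      rw [div_le_div_iff₀ hR0 (Real.exp_pos _), one_mul]
      exact h6
    calc 1 / (R : ℝ) ≤ 2 / Real.exp (L / 4) := h7
      _ = 2 * Real.exp (-(L / 4)) := by rw [Real.exp_neg, div_eq_mul_inv]
  have hexp48 : Real.exp (-(L / 4)) ≤ Real.exp (-(L / 8)) := Real.exp_le_exp.mpr (by linarith)
  -- `L² e^{-L/8} ≤ 128`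
  have hL2 : L ^ 2 * Real.exp (-(L / 8)) ≤ 128 := by
    have h1 : (L / 8) ^ 2 / 2 ≤ Real.exp (L / 8) := by
      have := Real.pow_div_factorial_le_exp (L / 8) (by positivity) 2
      norm_num [Nat.factorial] at this
      linarith
    have h2 : L ^ 2 ≤ 128 * Real.exp (L / 8) := by nlinarith
    have h3 : Real.exp (L / 8) * Real.exp (-(L / 8)) = 1 := by rw [← Real.exp_add]; simp
    calc L ^ 2 * Real.exp (-(L / 8)) ≤ 128 * Real.exp (L / 8) * Real.exp (-(L / 8)) :=
          mul_le_mul_of_nonneg_right h2 (Real.exp_pos _).le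
      _ = 128 := by rw [mul_assoc, h3, mul_one]
  -- abbreviations for the Möbius sums
  set mμ : ℕ → ℝ := fun M => ∑ k ∈ Icc 1 M, (μ k : ℝ) / k with hmμ
  set gμ : ℕ → ℝ := fun M => ∑ k ∈ Icc 1 M, (μ k : ℝ) * Real.log k / k with hgμ
  have hg0 : ∀ a : ℕ, (0 : ℝ) ≤ if IsSquare a then (1 : ℝ) else 0 := fun a => by
    split_ifs <;> norm_num
  have hg1 : ∀ a : ℕ, (if IsSquare a then (1 : ℝ) else 0) ≤ 1 := fun a => by
    split_ifs <;> norm_num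
  -- the identity, rewritten as `T₁ + T₂ − Z` with
  -- `T₁ = ∑ 𝟙_□ a⁻¹ log a · m(N/a)`, `T₂ = ∑ 𝟙_□ a⁻¹ (g(N/a) + 1)`, `Z = ∑ 𝟙_□ a⁻¹`
  have hid : ∑ n ∈ Icc 1 N, (liouville n : ℝ) * Real.log n / n + π ^ 2 / 6 =
      ∑ a ∈ Ioc 0 N, (if IsSquare a then (1 : ℝ) else 0) * ((a : ℝ)⁻¹ * (Real.log a * mμ (N / a))) +
      ∑ a ∈ Ioc 0 N, (if IsSquare a then (1 : ℝ) else 0) * ((a : ℝ)⁻¹ * (gμ (N / a) + 1)) -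
      (∑ a ∈ Ioc 0 N, (if IsSquare a then (1 : ℝ) else 0) * (a : ℝ)⁻¹ - π ^ 2 / 6) := by
    rw [sum_liouville_mul_log_div_eq N]
    have : ∀ a ∈ Ioc 0 N, (if IsSquare a then (1 : ℝ) else 0) *
        ((a : ℝ)⁻¹ * (Real.log a * ∑ k ∈ Icc 1 (N / a), (μ k : ℝ) / k +
          ∑ k ∈ Icc 1 (N / a), (μ k : ℝ) * Real.log k / k)) =
        (if IsSquare a then (1 : ℝ) else 0) * ((a : ℝ)⁻¹ * (Real.log a * mμ (N / a))) +
        (if IsSquare a then (1 : ℝ) else 0) * ((a : ℝ)⁻¹ * (gμ (N / a) + 1)) -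
        (if IsSquare a then (1 : ℝ) else 0) * (a : ℝ)⁻¹ := by
      intro a _
      simp only [hmμ, hgμ]
      ring
    rw [sum_congr rfl this, sum_sub_distrib, sum_add_distrib]
    ring
  rw [hid]
  -- bounds at `a ≤ A₀`: `x/a ≥ √x ≥ 4`, `√log(x/a) ≥ u/2`
  have hsmall : ∀ a ∈ Ioc 0 A₀, 2 ≤ x / a ∧ ⌊x / a⌋₊ = N / a ∧
      Real.exp (-c₀ * Real.sqrt (Real.log (x / a))) ≤ Real.exp (-(c₀ / 2) * u) := by
    intro a ha
    obtain ⟨ha0, haA⟩ := mem_Ioc.mp ha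
    have ha0' : (0 : ℝ) < a := by exact_mod_cast ha0
    have hax : (a : ℝ) ≤ Real.sqrt x := le_trans (by exact_mod_cast haA) hA₀le
    have hxa : Real.sqrt x ≤ x / a := by
      rw [← hxsx]
      exact div_le_div_of_nonneg_left hx0.le ha0' hax
    refine ⟨by linarith, Nat.floor_div_natCast x a, ?_⟩
    have hlxa : L / 2 ≤ Real.log (x / a) := by
      have : Real.log (Real.sqrt x) = L / 2 := by rw [hLdef, Real.log_sqrt hx0.le]
      rw [← this]
      exact Real.log_le_log hsx0 hxa
    have hsq : u / 2 ≤ Real.sqrt (Real.log (x / a)) := by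
      have h1 : Real.sqrt (L / 2) ≤ Real.sqrt (Real.log (x / a)) := Real.sqrt_le_sqrt hlxa
      have h2 : u / 2 ≤ Real.sqrt (L / 2) := by
        rw [hudef, Real.le_sqrt (by positivity) (by positivity), div_pow, Real.sq_sqrt hL0.le]
        linarith
      linarith
    exact Real.exp_le_exp.mpr (by nlinarith)
  -- trivial bounds at any `a ≤ N`: `N/a ≤ x`
  have hlogNa : ∀ a : ℕ, Real.log ((N / a : ℕ) : ℝ) ≤ L := by
    intro a
    rcases Nat.eq_zero_or_pos (N / a) with h0 | hpos
    · rw [h0, Nat.cast_zero, Real.log_zero]; exact hL0.le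
    · have : ((N / a : ℕ) : ℝ) ≤ x := le_trans (by exact_mod_cast Nat.div_le_self N a) hNx
      exact Real.log_le_log (by exact_mod_cast hpos) this
  -- Part 1a: `T₁` over `a ≤ A₀`
  have hK₁ := MoebiusLogSum.log_mul_exp_neg_mul_sqrt_le (a := c₀ / 4) (by positivity) hx1
  rw [← hLdef, ← hudef] at hK₁
  have hT1a : |∑ a ∈ Ioc 0 A₀, (if IsSquare a then (1 : ℝ) else 0) *
      ((a : ℝ)⁻¹ * (Real.log a * mμ (N / a)))| ≤ 2 * C₁ * (24 / (c₀ / 4) ^ 4 + 1) * E := by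
    have hterm : ∀ a ∈ Ioc 0 A₀, |(if IsSquare a then (1 : ℝ) else 0) *
        ((a : ℝ)⁻¹ * (Real.log a * mμ (N / a)))| ≤
        C₁ * (24 / (c₀ / 4) ^ 4 + 1) * E * ((if IsSquare a then (1 : ℝ) else 0) * (a : ℝ)⁻¹) := by
      intro a ha
      obtain ⟨ha0, haA⟩ := mem_Ioc.mp ha
      have ha0' : (0 : ℝ) < a := by exact_mod_cast ha0
      obtain ⟨hxa2, hfl, hexp⟩ := hsmall a ha
      have hM := hm (x / a) hxa2
      rw [hfl] at hM
      have hloga : 0 ≤ Real.log a := Real.log_nonneg (by exact_mod_cast ha0)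
      have hloga' : Real.log a ≤ L :=
        Real.log_le_log ha0' ((le_trans (by exact_mod_cast haA) hA₀le).trans hsxx)
      rw [abs_mul, abs_of_nonneg (hg0 a), abs_mul, abs_of_pos (inv_pos.mpr ha0'), abs_mul,
        abs_of_nonneg hloga]
      have hmb : |mμ (N / a)| ≤ C₁ * Real.exp (-(c₀ / 2) * u) := hM.trans (mul_le_mul_of_nonneg_left hexp hC₁)
      -- `log a · |m| ≤ L C₁ e^{-(c₀/2)u} = C₁ (L e^{-(c₀/4)u}) e^{-(c₀/4)u}`
      have hsplit : Real.exp (-(c₀ / 2) * u) = Real.exp (-(c₀ / 4 * u)) * E := by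
        rw [hEdef, ← Real.exp_add]; ring_nf
      have hkey : Real.log a * |mμ (N / a)| ≤ C₁ * (24 / (c₀ / 4) ^ 4 + 1) * E := by
        calc Real.log a * |mμ (N / a)| ≤ L * (C₁ * Real.exp (-(c₀ / 2) * u)) :=
              mul_le_mul hloga' hmb (abs_nonneg _) hL0.le
          _ = C₁ * (L * Real.exp (-(c₀ / 4 * u))) * E := by rw [hsplit]; ring
          _ ≤ C₁ * (24 / (c₀ / 4) ^ 4 + 1) * E :=
              mul_le_mul_of_nonneg_right (mul_le_mul_of_nonneg_left hK₁ hC₁) hE0.le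
      calc (if IsSquare a then (1 : ℝ) else 0) * ((a : ℝ)⁻¹ * (Real.log a * |mμ (N / a)|))
          ≤ (if IsSquare a then (1 : ℝ) else 0) * ((a : ℝ)⁻¹ * (C₁ * (24 / (c₀ / 4) ^ 4 + 1) * E)) :=
            mul_le_mul_of_nonneg_left (mul_le_mul_of_nonneg_left hkey (inv_pos.mpr ha0').le) (hg0 a)
        _ = C₁ * (24 / (c₀ / 4) ^ 4 + 1) * E * ((if IsSquare a then (1 : ℝ) else 0) * (a : ℝ)⁻¹) := by
            ring
    calc |∑ a ∈ Ioc 0 A₀, (if IsSquare a then (1 : ℝ) else 0) * ((a : ℝ)⁻¹ * (Real.log a * mμ (N / a)))|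
        ≤ ∑ a ∈ Ioc 0 A₀, |(if IsSquare a then (1 : ℝ) else 0) * ((a : ℝ)⁻¹ * (Real.log a * mμ (N / a)))| :=
          abs_sum_le_sum_abs _ _
      _ ≤ ∑ a ∈ Ioc 0 A₀, C₁ * (24 / (c₀ / 4) ^ 4 + 1) * E *
            ((if IsSquare a then (1 : ℝ) else 0) * (a : ℝ)⁻¹) := sum_le_sum hterm
      _ = C₁ * (24 / (c₀ / 4) ^ 4 + 1) * E *
            ∑ a ∈ Ioc 0 A₀, (if IsSquare a then (1 : ℝ) else 0) * (a : ℝ)⁻¹ := by rw [mul_sum]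
      _ ≤ C₁ * (24 / (c₀ / 4) ^ 4 + 1) * E * 2 :=
          mul_le_mul_of_nonneg_left (sum_indicator_isSquare_div_le_two A₀) (by positivity)
      _ = 2 * C₁ * (24 / (c₀ / 4) ^ 4 + 1) * E := by ring
  -- Part 1b: `T₂` over `a ≤ A₀`
  have hT2a : |∑ a ∈ Ioc 0 A₀, (if IsSquare a then (1 : ℝ) else 0) *
      ((a : ℝ)⁻¹ * (gμ (N / a) + 1))| ≤ 2 * C₂ * E := by
    have hterm : ∀ a ∈ Ioc 0 A₀, |(if IsSquare a then (1 : ℝ) else 0) *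
        ((a : ℝ)⁻¹ * (gμ (N / a) + 1))| ≤ C₂ * E * ((if IsSquare a then (1 : ℝ) else 0) * (a : ℝ)⁻¹) := by
      intro a ha
      obtain ⟨ha0, _⟩ := mem_Ioc.mp ha
      have ha0' : (0 : ℝ) < a := by exact_mod_cast ha0
      obtain ⟨hxa2, hfl, hexp⟩ := hsmall a ha
      have hG := hg (x / a) hxa2
      rw [hfl] at hG
      have hgb : |gμ (N / a) + 1| ≤ C₂ * E := hG.trans (mul_le_mul_of_nonneg_left (hexp.trans hE2) hC₂)
      rw [abs_mul, abs_of_nonneg (hg0 a), abs_mul, abs_of_pos (inv_pos.mpr ha0')]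
      calc (if IsSquare a then (1 : ℝ) else 0) * ((a : ℝ)⁻¹ * |gμ (N / a) + 1|)
          ≤ (if IsSquare a then (1 : ℝ) else 0) * ((a : ℝ)⁻¹ * (C₂ * E)) :=
            mul_le_mul_of_nonneg_left (mul_le_mul_of_nonneg_left hgb (inv_pos.mpr ha0').le) (hg0 a)
        _ = C₂ * E * ((if IsSquare a then (1 : ℝ) else 0) * (a : ℝ)⁻¹) := by ring
    calc |∑ a ∈ Ioc 0 A₀, (if IsSquare a then (1 : ℝ) else 0) * ((a : ℝ)⁻¹ * (gμ (N / a) + 1))|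
        ≤ ∑ a ∈ Ioc 0 A₀, |(if IsSquare a then (1 : ℝ) else 0) * ((a : ℝ)⁻¹ * (gμ (N / a) + 1))| :=
          abs_sum_le_sum_abs _ _
      _ ≤ ∑ a ∈ Ioc 0 A₀, C₂ * E * ((if IsSquare a then (1 : ℝ) else 0) * (a : ℝ)⁻¹) :=
          sum_le_sum hterm
      _ = C₂ * E * ∑ a ∈ Ioc 0 A₀, (if IsSquare a then (1 : ℝ) else 0) * (a : ℝ)⁻¹ := by rw [mul_sum]
      _ ≤ C₂ * E * 2 := mul_le_mul_of_nonneg_left (sum_indicator_isSquare_div_le_two A₀) (by positivity)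
      _ = 2 * C₂ * E := by ring
  -- Part 2: both sums over `A₀ < a ≤ N`, trivially
  have hW : ∑ a ∈ Ioc A₀ N, (if IsSquare a then (1 : ℝ) else 0) * (a : ℝ)⁻¹ ≤ 2 * Real.exp (-(L / 4)) :=
    (sum_indicator_isSquare_div_le_inv_sqrt hA₀1 N).trans hsqrtA
  have hT1b : |∑ a ∈ Ioc A₀ N, (if IsSquare a then (1 : ℝ) else 0) *
      ((a : ℝ)⁻¹ * (Real.log a * mμ (N / a)))| ≤ L * (1 + L) * (2 * Real.exp (-(L / 4))) := by
    have hterm : ∀ a ∈ Ioc A₀ N, |(if IsSquare a then (1 : ℝ) else 0) *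
        ((a : ℝ)⁻¹ * (Real.log a * mμ (N / a)))| ≤
        L * (1 + L) * ((if IsSquare a then (1 : ℝ) else 0) * (a : ℝ)⁻¹) := by
      intro a ha
      obtain ⟨haA, haN⟩ := mem_Ioc.mp ha
      have ha0 : 0 < a := lt_of_le_of_lt (Nat.zero_le _) haA
      have ha0' : (0 : ℝ) < a := by exact_mod_cast ha0
      have hloga : 0 ≤ Real.log a := Real.log_nonneg (by exact_mod_cast ha0)
      have hloga' : Real.log a ≤ L := Real.log_le_log ha0' (le_trans (by exact_mod_cast haN) hNx)
      have hmb : |mμ (N / a)| ≤ 1 + L :=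
        (abs_sum_moebius_div_le_one_add_log (N / a)).trans (by linarith [hlogNa a])
      rw [abs_mul, abs_of_nonneg (hg0 a), abs_mul, abs_of_pos (inv_pos.mpr ha0'), abs_mul,
        abs_of_nonneg hloga]
      calc (if IsSquare a then (1 : ℝ) else 0) * ((a : ℝ)⁻¹ * (Real.log a * |mμ (N / a)|))
          ≤ (if IsSquare a then (1 : ℝ) else 0) * ((a : ℝ)⁻¹ * (L * (1 + L))) :=
            mul_le_mul_of_nonneg_left (mul_le_mul_of_nonneg_left
              (mul_le_mul hloga' hmb (abs_nonneg _) hL0.le) (inv_pos.mpr ha0').le) (hg0 a)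
        _ = L * (1 + L) * ((if IsSquare a then (1 : ℝ) else 0) * (a : ℝ)⁻¹) := by ring
    calc |∑ a ∈ Ioc A₀ N, (if IsSquare a then (1 : ℝ) else 0) * ((a : ℝ)⁻¹ * (Real.log a * mμ (N / a)))|
        ≤ ∑ a ∈ Ioc A₀ N, |(if IsSquare a then (1 : ℝ) else 0) * ((a : ℝ)⁻¹ * (Real.log a * mμ (N / a)))| :=
          abs_sum_le_sum_abs _ _
      _ ≤ ∑ a ∈ Ioc A₀ N, L * (1 + L) * ((if IsSquare a then (1 : ℝ) else 0) * (a : ℝ)⁻¹) :=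
          sum_le_sum hterm
      _ = L * (1 + L) * ∑ a ∈ Ioc A₀ N, (if IsSquare a then (1 : ℝ) else 0) * (a : ℝ)⁻¹ := by
          rw [mul_sum]
      _ ≤ L * (1 + L) * (2 * Real.exp (-(L / 4))) := mul_le_mul_of_nonneg_left hW (by positivity)
  have hT2b : |∑ a ∈ Ioc A₀ N, (if IsSquare a then (1 : ℝ) else 0) *
      ((a : ℝ)⁻¹ * (gμ (N / a) + 1))| ≤ (1 + L * (1 + L)) * (2 * Real.exp (-(L / 4))) := by
    have hterm : ∀ a ∈ Ioc A₀ N, |(if IsSquare a then (1 : ℝ) else 0) *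
        ((a : ℝ)⁻¹ * (gμ (N / a) + 1))| ≤
        (1 + L * (1 + L)) * ((if IsSquare a then (1 : ℝ) else 0) * (a : ℝ)⁻¹) := by
      intro a ha
      obtain ⟨haA, _⟩ := mem_Ioc.mp ha
      have ha0 : 0 < a := lt_of_le_of_lt (Nat.zero_le _) haA
      have ha0' : (0 : ℝ) < a := by exact_mod_cast ha0
      have hgb : |gμ (N / a) + 1| ≤ 1 + L * (1 + L) := by
        have h1 := abs_sum_moebius_mul_log_div_le (N / a)
        have h2 := hlogNa a
        have h3 : 0 ≤ Real.log ((N / a : ℕ) : ℝ) := by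
          rcases Nat.eq_zero_or_pos (N / a) with h0 | hpos
          · rw [h0, Nat.cast_zero, Real.log_zero]
          · exact Real.log_nonneg (by exact_mod_cast hpos)
        calc |gμ (N / a) + 1| ≤ |gμ (N / a)| + |(1 : ℝ)| := abs_add_le _ _
          _ ≤ Real.log ((N / a : ℕ) : ℝ) * (1 + Real.log ((N / a : ℕ) : ℝ)) + 1 := by
              rw [abs_one]; exact add_le_add h1 le_rfl
          _ ≤ L * (1 + L) + 1 := by
              have := mul_le_mul h2 (by linarith : 1 + Real.log ((N / a : ℕ) : ℝ) ≤ 1 + L)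
                (by linarith) hL0.le
              linarith
          _ = 1 + L * (1 + L) := by ring
      rw [abs_mul, abs_of_nonneg (hg0 a), abs_mul, abs_of_pos (inv_pos.mpr ha0')]
      calc (if IsSquare a then (1 : ℝ) else 0) * ((a : ℝ)⁻¹ * |gμ (N / a) + 1|)
          ≤ (if IsSquare a then (1 : ℝ) else 0) * ((a : ℝ)⁻¹ * (1 + L * (1 + L))) :=
            mul_le_mul_of_nonneg_left (mul_le_mul_of_nonneg_left hgb (inv_pos.mpr ha0').le) (hg0 a)
        _ = (1 + L * (1 + L)) * ((if IsSquare a then (1 : ℝ) else 0) * (a : ℝ)⁻¹) := by ring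
    calc |∑ a ∈ Ioc A₀ N, (if IsSquare a then (1 : ℝ) else 0) * ((a : ℝ)⁻¹ * (gμ (N / a) + 1))|
        ≤ ∑ a ∈ Ioc A₀ N, |(if IsSquare a then (1 : ℝ) else 0) * ((a : ℝ)⁻¹ * (gμ (N / a) + 1))| :=
          abs_sum_le_sum_abs _ _
      _ ≤ ∑ a ∈ Ioc A₀ N, (1 + L * (1 + L)) * ((if IsSquare a then (1 : ℝ) else 0) * (a : ℝ)⁻¹) :=
          sum_le_sum hterm
      _ = (1 + L * (1 + L)) * ∑ a ∈ Ioc A₀ N, (if IsSquare a then (1 : ℝ) else 0) * (a : ℝ)⁻¹ := by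
          rw [mul_sum]
      _ ≤ (1 + L * (1 + L)) * (2 * Real.exp (-(L / 4))) := mul_le_mul_of_nonneg_left hW (by positivity)
  have hPart2 : L * (1 + L) * (2 * Real.exp (-(L / 4))) + (1 + L * (1 + L)) * (2 * Real.exp (-(L / 4))) ≤
      1280 * E := by
    have h1 : L * (1 + L) + (1 + L * (1 + L)) ≤ 5 * L ^ 2 := by nlinarith
    calc L * (1 + L) * (2 * Real.exp (-(L / 4))) + (1 + L * (1 + L)) * (2 * Real.exp (-(L / 4)))
        = (L * (1 + L) + (1 + L * (1 + L))) * (2 * Real.exp (-(L / 4))) := by ring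
      _ ≤ 5 * L ^ 2 * (2 * Real.exp (-(L / 4))) := mul_le_mul_of_nonneg_right h1 (by positivity)
      _ = 10 * (L ^ 2 * Real.exp (-(L / 8))) * Real.exp (-(L / 8)) := by
          have : Real.exp (-(L / 4)) = Real.exp (-(L / 8)) * Real.exp (-(L / 8)) := by
            rw [← Real.exp_add]; ring_nf
          rw [this]; ring
      _ ≤ 10 * 128 * Real.exp (-(L / 8)) :=
          mul_le_mul_of_nonneg_right (mul_le_mul_of_nonneg_left hL2 (by norm_num)) (Real.exp_pos _).le
      _ ≤ 10 * 128 * E := mul_le_mul_of_nonneg_left hE8 (by norm_num)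
      _ = 1280 * E := by norm_num
  -- the `ζ(2)` term
  have hZ : |∑ a ∈ Ioc 0 N, (if IsSquare a then (1 : ℝ) else 0) * (a : ℝ)⁻¹ - π ^ 2 / 6| ≤ 2 * E := by
    refine (abs_sum_indicator_isSquare_div_sub_le hN1).trans ?_
    have hmono : (Nat.sqrt A₀ : ℝ) ≤ Nat.sqrt N := by exact_mod_cast Nat.sqrt_le_sqrt hA₀N
    have hR0 : (0 : ℝ) < Nat.sqrt A₀ := by exact_mod_cast Nat.sqrt_pos.mpr (by omega)
    calc 1 / (Nat.sqrt N : ℝ) ≤ 1 / (Nat.sqrt A₀ : ℝ) := one_div_le_one_div_of_le hR0 hmono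
      _ ≤ 2 * Real.exp (-(L / 4)) := hsqrtA
      _ ≤ 2 * Real.exp (-(L / 8)) := by linarith [hexp48]
      _ ≤ 2 * E := by linarith [hE8]
  -- splitting `T₁`, `T₂` at `A₀`
  have hT1 : |∑ a ∈ Ioc 0 N, (if IsSquare a then (1 : ℝ) else 0) * ((a : ℝ)⁻¹ * (Real.log a * mμ (N / a)))| ≤
      2 * C₁ * (24 / (c₀ / 4) ^ 4 + 1) * E + L * (1 + L) * (2 * Real.exp (-(L / 4))) := by
    rw [← sum_Ioc_consecutive _ (Nat.zero_le A₀) hA₀N]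
    exact (abs_add_le _ _).trans (add_le_add hT1a hT1b)
  have hT2 : |∑ a ∈ Ioc 0 N, (if IsSquare a then (1 : ℝ) else 0) * ((a : ℝ)⁻¹ * (gμ (N / a) + 1))| ≤
      2 * C₂ * E + (1 + L * (1 + L)) * (2 * Real.exp (-(L / 4))) := by
    rw [← sum_Ioc_consecutive _ (Nat.zero_le A₀) hA₀N]
    exact (abs_add_le _ _).trans (add_le_add hT2a hT2b)
  -- assembly
  have habs : ∀ p q r : ℝ, |p + q - r| ≤ |p| + |q| + |r| := fun p q r =>
    (abs_sub _ _).trans (by linarith [abs_add_le p q])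
  refine (habs _ _ _).trans ?_
  have hK0 : 0 ≤ 24 / (c₀ / 4) ^ 4 + 1 := by positivity
  nlinarith [hT1, hT2, hZ, hPart2, hE0.le, mul_nonneg hC₁ hK0]

end LiouvilleSum

open LiouvilleSum in
/-- **`∑_{n ≤ x} λ(n) log n / n = −π²/6 + O(exp(−c √log x))`** for the Liouville function: there are
`c > 0` and `C` with `|∑_{n ≤ x} λ(n) log n/n + π²/6| ≤ C exp(−c√log x)` for all `x ≥ 2`
(`π²/6 = ζ(2) = −(d/ds)(ζ(2s)/ζ(s))|_{s=1}·(−1)`; from `λ = 𝟙_□ ⋆ μ`, `∑ μ(k)/k ≪ e^{−c√log}`,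
`∑ μ(k) log k/k = −1 + O(e^{−c√log})` and `∑_{r ≤ R} r⁻² = π²/6 + O(1/R)`).
[cite: MontgomeryVaughan2007, §6.2.1 Exercise 11] -/
theorem abs_sum_liouville_mul_log_div_add_le :
    ∃ c : ℝ, 0 < c ∧ ∃ C : ℝ, ∀ x : ℝ, 2 ≤ x →
      |∑ n ∈ Icc 1 ⌊x⌋₊, (liouville n : ℝ) * Real.log n / n + π ^ 2 / 6| ≤
        C * Real.exp (-c * Real.sqrt (Real.log x)) := by
  obtain ⟨c₁, hc₁, C₁, hm⟩ := abs_sum_moebius_div_le_exp_neg_sqrt_log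
  obtain ⟨c₂, hc₂, C₂, hg⟩ := abs_sum_moebius_mul_log_div_add_one_le
  -- shrink the constants: `c₀ = min (min c₁ c₂) (1/4)`, `Cᵢ' = max Cᵢ 0`
  set c₀ : ℝ := min (min c₁ c₂) (1 / 4) with hc₀
  have hc₀0 : 0 < c₀ := lt_min (lt_min hc₁ hc₂) (by norm_num)
  have hc₀' : c₀ ≤ 1 / 4 := min_le_right _ _
  have hc₀1 : c₀ ≤ c₁ := (min_le_left _ _).trans (min_le_left _ _)
  have hc₀2 : c₀ ≤ c₂ := (min_le_left _ _).trans (min_le_right _ _)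
  have hmono : ∀ {c C : ℝ} (y : ℝ), c₀ ≤ c → C * Real.exp (-c * Real.sqrt (Real.log y)) ≤
      max C 0 * Real.exp (-c₀ * Real.sqrt (Real.log y)) := by
    intro c C y hc
    have h1 : Real.exp (-c * Real.sqrt (Real.log y)) ≤ Real.exp (-c₀ * Real.sqrt (Real.log y)) :=
      Real.exp_le_exp.mpr (mul_le_mul_of_nonneg_right (neg_le_neg hc) (Real.sqrt_nonneg _))
    calc C * Real.exp (-c * Real.sqrt (Real.log y)) ≤ max C 0 * Real.exp (-c * Real.sqrt (Real.log y)) :=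
          mul_le_mul_of_nonneg_right (le_max_left _ _) (Real.exp_pos _).le
      _ ≤ max C 0 * Real.exp (-c₀ * Real.sqrt (Real.log y)) :=
          mul_le_mul_of_nonneg_left h1 (le_max_right _ _)
  have hm' : ∀ y : ℝ, 2 ≤ y → |∑ k ∈ Icc 1 ⌊y⌋₊, (μ k : ℝ) / k| ≤
      max C₁ 0 * Real.exp (-c₀ * Real.sqrt (Real.log y)) := fun y hy => (hm y hy).trans (hmono y hc₀1)
  have hg' : ∀ y : ℝ, 2 ≤ y → |∑ k ∈ Icc 1 ⌊y⌋₊, (μ k : ℝ) * Real.log k / k + 1| ≤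
      max C₂ 0 * Real.exp (-c₀ * Real.sqrt (Real.log y)) := fun y hy => (hg y hy).trans (hmono y hc₀2)
  refine ⟨c₀ / 4, by positivity, ?_⟩
  exact forall_two_le_of_forall_ge_exp_sq (fun x hx => abs_sum_liouville_mul_log_div_add_le_sq hx)
    fun x hx => abs_sum_liouville_mul_log_div_add_le_of_bound hc₀0 hc₀' (le_max_right _ _)
      (le_max_right _ _) hm' hg' hx

open LiouvilleSum in
/-- **`∑_{n=1}^∞ λ(n) log n / n = −π²/6 = −ζ(2)`**: the partial sums tend to `−π²/6`.
[cite: MontgomeryVaughan2007, §6.2.1 Exercise 11] -/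
theorem tendsto_sum_liouville_mul_log_div :
    Tendsto (fun N : ℕ => ∑ n ∈ Icc 1 N, (liouville n : ℝ) * Real.log n / n) atTop
      (nhds (-(π ^ 2 / 6))) := by
  obtain ⟨c, hc, C, h⟩ := abs_sum_liouville_mul_log_div_add_le
  have hlim : Tendsto (fun N : ℕ => C * Real.exp (-c * Real.sqrt (Real.log N))) atTop
      (nhds (C * 0)) := by
    refine Tendsto.const_mul C ?_
    refine Real.tendsto_exp_atBot.comp ?_
    have h1 : Tendsto (fun N : ℕ => Real.sqrt (Real.log N)) atTop atTop :=
      Real.tendsto_sqrt_atTop.comp (Real.tendsto_log_atTop.comp tendsto_natCast_atTop_atTop)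
    exact h1.const_mul_atTop_of_neg (by linarith : -c < 0)
  rw [mul_zero] at hlim
  have key : Tendsto (fun N : ℕ => ∑ n ∈ Icc 1 N, (liouville n : ℝ) * Real.log n / n + π ^ 2 / 6)
      atTop (nhds 0) := by
    refine squeeze_zero_norm' ?_ hlim
    filter_upwards [eventually_ge_atTop 2] with N hN
    rw [Real.norm_eq_abs]
    have := h N (by exact_mod_cast hN)
    rwa [Nat.floor_natCast] at this
  have := key.add_const (-(π ^ 2 / 6))
  simpa using this

end Literature.NumberTheory.LFunctions
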